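import Summits.Ventures.PercRepro.RankLevelSetUpFiveMem

/-! # RankLevelSetUpFiveSmall — (↑) AT LEVEL `5` OUTSIDE A SERIES CLASS OF SIZE `≥ 4` WHEN THE REST HAS `≤ 8`
ELEMENTS (night-1 g40; dossier §52; on `RankLevelSetUpFiveMem`)

With `N = M✶` loopless of rank `4`, `P = cl {p}` of `q ≥ 4` elements, `b ∉ P` and `f = #(E ∖ P) ≤ 8`, the exact
sorts `T_5 = A_5 + q g_4 + C(q,2) g_3` and `V_6 = Ā_6 + q ḡ_5 + C(q,2) ḡ_4 + C(q,3) ḡ_3` of `RankLevelSetUpFiveSort`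
are compared through the complementation `ḡ_k = g_{f−k}` of the contraction (`avoidHat_ncard_eq_throughHat_compl`)
and the vanishing of the small families (**`upFull_five_eq_empty_of_le_seven`**, **`throughHat_eq_empty_of_le`**):
`f = 8` — `A_5 ≤ g_5` (**`upFull_subset_throughHat`**), `g_3 ≤ g_4` ((↑)₃ of the deletion) and `C(q,2) ≥ q`
(**`le_choose_two`**); `f = 7` — `A_5 = 0` and `C(q,3) ≥ q`; `f = 6` — `A_5 = g_4 = 0` and `C(q,3) ≥ C(q,2)` for
`q ≥ 5` (**`choose_two_le_choose_three`**); `f ≤ 5` — `T_5 = 0`. Hence **`upAt_five_of_seriesClass_small`**: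
`M` coloop-free of nullity `4`, `#cl✶ {p} ≥ 4`, `b ∉ cl✶ {p}`, `#(E ∖ cl✶ {p}) ≤ 8`, `12 ≤ #E` ⟹
`BiIndepUpAt M b 5`. Every declaration has a docstring; imports: the cell's own modules and Mathlib only.
Axioms: standard. (Refiled byte-for-byte but for this sentence after the post-accept olean build of p741561 was
dropped.) -/

namespace PercRepro

open Set Matroid

variable {α : Type}

/-! ## Arithmetic -/

/-- `n ≤ C(n, 2)` for `n ≥ 3`: `C(3,2) = 3` and `C(n+1, 2) = n + C(n, 2) ≥ n + 1`. -/
lemma le_choose_two (n : ℕ) (hn : 3 ≤ n) : n ≤ n.choose 2 := by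
  induction n with
  | zero => omega
  | succ m ih =>
    rcases Nat.lt_or_ge m 3 with hm | hm
    · have : m = 2 := by omega
      subst this; decide
    · have h1 := ih hm
      have h2 : (m + 1).choose 2 = m.choose 1 + m.choose 2 := Nat.choose_succ_succ m 1
      rw [Nat.choose_one_right] at h2
      omega

/-- `C(n, 2) ≤ C(n, 3)` for `n ≥ 5`: `3 · C(n,3) = (n − 2) · C(n,2)` (`Nat.choose_succ_right_eq`). -/
lemma choose_two_le_choose_three (n : ℕ) (hn : 5 ≤ n) : n.choose 2 ≤ n.choose 3 := by
  have h : n.choose (2 + 1) * (2 + 1) = n.choose 2 * (n - 2) := Nat.choose_succ_right_eq n 2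
  have h3 : n.choose 2 * 3 ≤ n.choose 2 * (n - 2) := Nat.mul_le_mul_left _ (by omega)
  have h' : n.choose 2 * 3 ≤ n.choose 3 * 3 := by
    have e : (2 + 1 : ℕ) = 3 := rfl
    rw [e] at h
    omega
  exact Nat.le_of_mul_le_mul_right h' (by norm_num)

/-! ## The small families -/

variable (N : Matroid α) [N.Finite]

/-- **`A_5` is empty when `#(E ∖ cl {p}) ≤ 7`** (`rk N = 4`): the complement of a member, together with `p`, has at
most three elements and cannot span. -/
lemma upFull_five_eq_empty_of_le_seven (hr : N.eRank = 4) {p b : α} (h7 : (N.E \ N.closure {p}).ncard ≤ 7) :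
    upFull N p b 5 = ∅ := by
  set E' := N.E \ N.closure {p} with hE'
  have hE'fin : E'.Finite := N.ground_finite.subset Set.sdiff_subset
  rw [Set.eq_empty_iff_forall_notMem]
  rintro W ⟨hWE, hW5, -, -, hWc⟩
  have h1 := eRank_le_encard_of_spanning hWc
  have hfin : (insert p (E' \ W)).Finite := (hE'fin.subset Set.sdiff_subset).insert p
  rw [hr, hfin.encard_eq_coe_toFinset_card, ← Set.ncard_eq_toFinset_card _ hfin] at h1
  have h2 : (insert p (E' \ W)).ncard ≤ (E' \ W).ncard + 1 := Set.ncard_insert_le p _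
  have h3 : (E' \ W).ncard = E'.ncard - 5 := by rw [Set.ncard_sdiff hWE (hE'fin.subset hWE), hW5]
  have h4 : (4 : ℕ) ≤ (insert p (E' \ W)).ncard := by exact_mod_cast h1
  omega

/-- **`g_k` is empty when `#(E ∖ cl {p}) ≤ k + 2`** (`rk N = 4`): the complement of a member, together with `p`, has
at most three elements and cannot span. -/
lemma throughHat_eq_empty_of_le (hr : N.eRank = 4) {p b : α} {k : ℕ} (hk : (N.E \ N.closure {p}).ncard ≤ k + 2) :
    throughHat N p b k = ∅ := by
  set E' := N.E \ N.closure {p} with hE'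
  have hE'fin : E'.Finite := N.ground_finite.subset Set.sdiff_subset
  rw [Set.eq_empty_iff_forall_notMem]
  rintro U ⟨hUE, hUk, -, -, hUc⟩
  have h1 := eRank_le_encard_of_spanning hUc
  have hfin : (insert p (E' \ U)).Finite := (hE'fin.subset Set.sdiff_subset).insert p
  rw [hr, hfin.encard_eq_coe_toFinset_card, ← Set.ncard_eq_toFinset_card _ hfin] at h1
  have h2 : (insert p (E' \ U)).ncard ≤ (E' \ U).ncard + 1 := Set.ncard_insert_le p _
  have h3 : (E' \ U).ncard = E'.ncard - k := by rw [Set.ncard_sdiff hUE (hE'fin.subset hUE), hUk]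
  have h4 : (4 : ℕ) ≤ (insert p (E' \ U)).ncard := by exact_mod_cast h1
  omega

omit [N.Finite] in
/-- **`A_k ⊆ g_k`**: a member of the mixed family spans `N`, hence spans together with `p`. -/
lemma upFull_subset_throughHat {p : α} (hp : p ∈ N.E) (b : α) (k : ℕ) : upFull N p b k ⊆ throughHat N p b k := by
  rintro W ⟨hWE, hWk, hbW, hWs, hWc⟩
  exact ⟨hWE, hWk, hbW, hWs.superset (Set.subset_insert p W) (Set.insert_subset hp hWs.subset_ground), hWc⟩

/-! ## The theorem -/

variable (M : Matroid α) [M.Finite]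

/-- **(↑) AT LEVEL `5` OUTSIDE A SERIES CLASS OF SIZE `≥ 4` WHEN `#(E ∖ cl✶ {p}) ≤ 8`** (`M` coloop-free of
nullity `4`, `b ∉ cl✶ {p}`, `12 ≤ #E`): the exact sorts of `T_5` and `V_6` along the class, complementation
`ḡ_k = g_{f−k}` in the contraction, and the small cases `f = 8` (`A_5 ≤ g_5`, `g_3 ≤ g_4`, `C(q,2) ≥ q`), `f = 7`
(`A_5 = 0`, `C(q,3) ≥ q`), `f = 6` (`A_5 = g_4 = 0`, `C(q,3) ≥ C(q,2)`), `f ≤ 5` (`T_5 = 0`). -/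
theorem upAt_five_of_seriesClass_small (hcol : ∀ e, ¬ M.IsColoop e) (hν : M✶.eRank = 4) {p : α} (hp : p ∈ M.E)
    (hq : 4 ≤ (M✶.closure {p}).ncard) {b : α} (hb : b ∈ M.E) (hbP : b ∉ M✶.closure {p})
    (h8 : (M.E \ M✶.closure {p}).ncard ≤ 8) (hn : 12 ≤ M.E.ncard) : BiIndepUpAt M b 5 := by
  classical
  have hnl := dual_isNonloop_of_coloopFree' M hcol
  have hpE : p ∈ M✶.E := by rwa [Matroid.dual_ground]
  have hbE : b ∈ M✶.E := by rwa [Matroid.dual_ground]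
  have hPE : M✶.closure {p} ⊆ M✶.E := M✶.closure_subset_ground _
  have hE'card : (M✶.E \ M✶.closure {p}).ncard + (M✶.closure {p}).ncard = M.E.ncard := by
    rw [Set.ncard_sdiff hPE (M.ground_finite.subset hPE), Matroid.dual_ground]
    have := Set.ncard_le_ncard hPE M.ground_finite
    rw [Matroid.dual_ground] at this
    omega
  have h8' : (M✶.E \ M✶.closure {p}).ncard ≤ 8 := by rw [Matroid.dual_ground]; exact h8
  unfold BiIndepUpAt
  rw [biIndep_eq_biSpan_dual, biIndep_eq_biSpan_dual]
  rw [through_five_eq_of_three_le M✶ hnl hν hpE (by omega) hbP, avoid_six_eq_of_four_le M✶ hnl hν hpE hq hbP]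
  have hcomp : ∀ k, k ≤ (M✶.E \ M✶.closure {p}).ncard →
      (avoidHat M✶ p b k).ncard = (throughHat M✶ p b ((M✶.E \ M✶.closure {p}).ncard - k)).ncard :=
    fun k hk => avoidHat_ncard_eq_throughHat_compl M✶ hbE hbP hk
  have hA5 : (upFull M✶ p b 5).ncard ≤ (throughHat M✶ p b 5).ncard :=
    Set.ncard_le_ncard (upFull_subset_throughHat M✶ hpE b 5) (throughHat_finite M✶ p b 5)
  rcases Nat.lt_or_ge (M✶.E \ M✶.closure {p}).ncard 6 with hlt6 | hge6
  · -- `f ≤ 5`: every through family is empty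
    rw [upFull_five_eq_empty_of_le_seven M✶ hν (by omega), throughHat_eq_empty_of_le M✶ hν (k := 4) (by omega),
      throughHat_eq_empty_of_le M✶ hν (k := 3) (by omega), Set.ncard_empty]
    omega
  rcases Nat.lt_or_ge (M✶.E \ M✶.closure {p}).ncard 7 with hlt7 | hge7
  · -- `f = 6`: `A_5 = g_4 = 0`, `ḡ_3 = g_3`, `C(q,2) ≤ C(q,3)`
    have e : (M✶.E \ M✶.closure {p}).ncard = 6 := by omega
    rw [upFull_five_eq_empty_of_le_seven M✶ hν (by omega), throughHat_eq_empty_of_le M✶ hν (k := 4) (by omega),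
      Set.ncard_empty, hcomp 3 (by omega), e]
    simp only [Nat.reduceSub]
    have h23 := choose_two_le_choose_three (M✶.closure {p}).ncard (by omega)
    have hm : (M✶.closure {p}).ncard.choose 2 * (throughHat M✶ p b 3).ncard ≤
        (M✶.closure {p}).ncard.choose 3 * (throughHat M✶ p b 3).ncard := Nat.mul_le_mul_right _ h23
    omega
  rcases Nat.lt_or_ge (M✶.E \ M✶.closure {p}).ncard 8 with hlt8 | hge8
  · -- `f = 7`: `A_5 = 0`, `ḡ_4 = g_3`, `ḡ_3 = g_4`, `C(q,3) ≥ q`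
    have e : (M✶.E \ M✶.closure {p}).ncard = 7 := by omega
    rw [upFull_five_eq_empty_of_le_seven M✶ hν (by omega), Set.ncard_empty, hcomp 4 (by omega),
      hcomp 3 (by omega), e]
    simp only [Nat.reduceSub]
    have h3 := le_choose_three (M✶.closure {p}).ncard hq
    have hm : (M✶.closure {p}).ncard * (throughHat M✶ p b 4).ncard ≤
        (M✶.closure {p}).ncard.choose 3 * (throughHat M✶ p b 4).ncard := Nat.mul_le_mul_right _ h3
    omega
  · -- `f = 8`: `A_5 ≤ g_5 = ḡ_3`, `ḡ_4 = g_4`, `ḡ_5 = g_3`, `g_3 ≤ g_4`, `C(q,2) ≥ q`, `C(q,3) ≥ 1`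
    have e : (M✶.E \ M✶.closure {p}).ncard = 8 := by omega
    have hg34 : (throughHat M✶ p b 3).ncard ≤ (avoidHat M✶ p b 4).ncard :=
      throughHat_three_le_avoidHat_four M hcol hν hp hb hbP (by rw [← Matroid.dual_ground]; omega)
    rw [hcomp 4 (by omega), e] at hg34
    rw [hcomp 5 (by omega), hcomp 4 (by omega), hcomp 3 (by omega), e]
    simp only [Nat.reduceSub] at hg34 ⊢
    obtain ⟨d, hd⟩ : ∃ d, (M✶.closure {p}).ncard.choose 2 = (M✶.closure {p}).ncard + d :=
      ⟨_, (Nat.add_sub_cancel' (le_choose_two _ (by omega))).symm⟩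
    have h3 : 1 ≤ (M✶.closure {p}).ncard.choose 3 := Nat.choose_pos (by omega)
    have hm3 : (throughHat M✶ p b 5).ncard ≤ (M✶.closure {p}).ncard.choose 3 * (throughHat M✶ p b 5).ncard := by
      calc (throughHat M✶ p b 5).ncard = 1 * (throughHat M✶ p b 5).ncard := (one_mul _).symm
        _ ≤ _ := Nat.mul_le_mul_right _ h3
    have hd3 : (M✶.closure {p}).ncard.choose 2 * (throughHat M✶ p b 3).ncard =
        (M✶.closure {p}).ncard * (throughHat M✶ p b 3).ncard + d * (throughHat M✶ p b 3).ncard := by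
      rw [hd, Nat.add_mul]
    have hd4 : (M✶.closure {p}).ncard.choose 2 * (throughHat M✶ p b 4).ncard =
        (M✶.closure {p}).ncard * (throughHat M✶ p b 4).ncard + d * (throughHat M✶ p b 4).ncard := by
      rw [hd, Nat.add_mul]
    have hdd : d * (throughHat M✶ p b 3).ncard ≤ d * (throughHat M✶ p b 4).ncard := Nat.mul_le_mul_left _ hg34
    omega

end PercRepro
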